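import Mathlib
import HarnessLib
import Literature.Geometry.Lorentzian.KissingBallsCutMass
import Literature.Geometry.Lorentzian.HypersurfaceRestriction
import Literature.Geometry.Lorentzian.KerrConvergence
import Summits.FinalStateConjecture.FinalStateConjecture.Theorems.BondiDrainDispersalDrainImpliesDisperseReduction

/-!
# Crux `DrainImpliesDisperse` (stmt-FinalStateConjecture-17283), line `registered` — ANTI-VACUITY of the
# one open stub's conclusion: Minkowski space carries a horizonless radiative end

Lead c2, 2026-08-17 (skeleton reshape r2). The registered open stub `stub_radiativeEnd` asks, for a drained
censored MGHD, for a HORIZONLESS RADIATIVE END `(τ₀, Ψ)`: (E1) `Ψ : E4 → M` smooth and an open embedding of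
`{x⁰ > τ₀}`; (E2) `Ψ{x⁰ ≥ τ₀}` closed; (E3) `Ψ{x⁰ > τ₀} ⊆ J⁺(ι X)`; (E4) `Ψ_*∂₀` future timelike on
`{x⁰ ≥ τ₀}`; (E5) `deviationCk Minkowski.background Ψ 2 τ → 0`; (E6) `J⁺(ι X) ⊆ I⁻(Ψ{x⁰ > τ₀})`. Clauses
(E2) (properness) and (E6) (no horizon) are stronger than what the crux's conclusion returns, so their JOINT
satisfiability with (E1), (E3)–(E5) in an actual vacuum Cauchy development must be certified (BC3-style
anti-vacuity of the reshaped stub). This file does so on the model every dispersing development converges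
to: in the Minkowski development of the trivial datum (`Minkowski.vacuumCauchyDevelopment`: carrier `E4`,
metric `η`, orientation `∂ₜ`, data slice `{x⁰ = 0}`), the IDENTITY chart `Ψ = Subtype.val : (⊤ : Opens E4) → E4`
with `τ₀ = 0` is a horizonless radiative end (`minkowski_horizonlessRadiativeEnd`): the deviation vanishes
identically (`dΨ = id`), `{x⁰ ≥ 0}` is closed, `{x⁰ > 0} ⊆ J⁺({x⁰ = 0})` along vertical segments
(`Minkowski.causalFuture_singleton`), `∂ₜ` is future timelike, and EVERY event `q` lies in `I⁻({x⁰ > 0})`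
(vertical timelike segment to `(max(q⁰,0) + 1, q̲)`, `Minkowski.mem_chronologicalFuture_of_spatial_eq`).
With the landed reduction `settles_of_horizonlessRadiativeEnd` (p149007) this gives `minkowski_settlesT2`: the
Minkowski development satisfies the crux's `N = 0` conclusion verbatim (T2 clauses included) — the conclusion of
`DrainImpliesDisperse` is inhabited on the model to which every dispersing development converges. Mathlib + the
Literature cone + the landed reduction; no definitions, no named facts.
-/

noncomputable section

open scoped Manifold ContDiff Topology
open Filter Set Topology TopologicalSpace Literature.Geometry.Lorentzian

namespace Summit.FinalStateConjecture.FinalStateConjecture.Theorems.DrainImpliesDisperse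

-- D-0017: single-problem summit, `Summit.<S>.<S>.…` by design
-- (cf. lakefile `weak.linter.dupNamespace`).
set_option linter.dupNamespace false

open Minkowski in
/-- **Minkowski space carries a horizonless radiative end** (anti-vacuity of the conclusion of the open stub
`stub_radiativeEnd` of crux stmt-FinalStateConjecture-17283, reshape r2): in the Minkowski development of
the trivial datum, `τ₀ = 0` and the identity chart `Ψ = Subtype.val : (⊤ : Opens E4) → E4` satisfy
(E1)–(E6): smooth open embedding of `{x⁰ > 0}`; `{x⁰ ≥ 0}` closed; `{x⁰ > 0} ⊆ J⁺({x⁰ = 0})`; `dΨ(∂₀) = ∂₀`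
future timelike; `deviationCk … 2 τ = 0` for every `τ`; every event lies in `I⁻({x⁰ > 0})`. -/
theorem minkowski_horizonlessRadiativeEnd :
    ∃ (τ₀ : ℝ) (Ψ : Minkowski.background.domain → Minkowski.vacuumCauchyDevelopment.carrier),
      ContMDiff 𝓘(ℝ, E4) (𝓡 4) ∞ Ψ ∧
      IsOpenEmbedding ((Minkowski.background.lateRegion τ₀).restrict Ψ) ∧
      IsClosed (Ψ '' {x : Minkowski.background.domain | τ₀ ≤ x.1 0}) ∧
      Ψ '' Minkowski.background.lateRegion τ₀ ⊆
        Minkowski.vacuumCauchyDevelopment.metric.causalFuture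
          Minkowski.vacuumCauchyDevelopment.timeOrientation
          (range Minkowski.vacuumCauchyDevelopment.embed) ∧
      (∀ x : Minkowski.background.domain, τ₀ ≤ x.1 0 →
        Minkowski.vacuumCauchyDevelopment.metric.IsTimelike
            (mfderiv 𝓘(ℝ, E4) (𝓡 4) Ψ x (E4.basisVector 0)) ∧
          Minkowski.vacuumCauchyDevelopment.timeOrientation.IsFutureDirected
            (mfderiv 𝓘(ℝ, E4) (𝓡 4) Ψ x (E4.basisVector 0))) ∧
      Tendsto (fun τ ↦ Minkowski.vacuumCauchyDevelopment.toSpacetime.deviationCk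
        Minkowski.background Ψ 2 τ) atTop (𝓝 0) ∧
      Minkowski.vacuumCauchyDevelopment.metric.causalFuture
          Minkowski.vacuumCauchyDevelopment.timeOrientation
          (range Minkowski.vacuumCauchyDevelopment.embed) ⊆
        Minkowski.vacuumCauchyDevelopment.metric.chronologicalPast
          Minkowski.vacuumCauchyDevelopment.timeOrientation
          (Ψ '' Minkowski.background.lateRegion τ₀) := by
  -- the identity chart of the flat background (domain all of `E4`) into the carrier `E4`
  let Ψ : Minkowski.background.domain → Minkowski.vacuumCauchyDevelopment.carrier := Subtype.val
  have hΨ : ∀ x, Ψ x = x.1 := fun _ ↦ rfl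
  -- its differential is the identity
  have hmf : ∀ x : Minkowski.background.domain,
      mfderiv 𝓘(ℝ, E4) (𝓡 4) Ψ x = ContinuousLinearMap.id ℝ E4 := fun x ↦
    mfderiv_subtypeVal (I' := 𝓘(ℝ, E4)) (W := (⊤ : Opens E4)) x
  have happ : ∀ (x : Minkowski.background.domain) (v : E4),
      mfderiv 𝓘(ℝ, E4) (𝓡 4) Ψ x v = v := fun x v ↦ by
    have h := congrArg (fun L : TangentSpace 𝓘(ℝ, E4) x →L[ℝ] TangentSpace (𝓡 4) (Ψ x) ↦ L v) (hmf x)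
    exact h
  -- the late region and its image
  have hU : Ψ '' Minkowski.background.lateRegion 0 = {y : E4 | 0 < y 0} := by
    ext y
    simp only [Set.mem_image, ModelBackground.mem_lateRegion]
    constructor
    · rintro ⟨x, hx, rfl⟩
      exact hx
    · intro hy
      exact ⟨⟨y, trivial⟩, hy, rfl⟩
  refine ⟨0, Ψ, ?_, ?_, ?_, ?_, ?_, ?_, ?_⟩
  · -- (E1a) smooth
    exact contMDiff_subtype_val
  · -- (E1b) open embedding of the (open) late region
    have h1 : IsOpenEmbedding (Subtype.val : Minkowski.background.domain → E4) :=
      (⊤ : Opens E4).isOpen.isOpenEmbedding_subtypeVal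
    have h2 : IsOpen (Minkowski.background.lateRegion 0) :=
      isOpen_lt continuous_const ((EuclideanSpace.proj (0 : Fin 4)).continuous.comp continuous_subtype_val)
    exact h1.comp h2.isOpenEmbedding_subtypeVal
  · -- (E2) properness: the image of `{x⁰ ≥ 0}` is the closed half-space
    have h : Ψ '' {x : Minkowski.background.domain | (0 : ℝ) ≤ x.1 0} = {y : E4 | 0 ≤ y 0} := by
      ext y
      simp only [Set.mem_image, Set.mem_setOf_eq]
      constructor
      · rintro ⟨x, hx, rfl⟩
        exact hx
      · intro hy
        exact ⟨⟨y, trivial⟩, hy, rfl⟩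
    rw [h]
    exact isClosed_le continuous_const (EuclideanSpace.proj (0 : Fin 4)).continuous
  · -- (E3) `{x⁰ > 0} ⊆ J⁺({x⁰ = 0})`: vertical causal segment from `(0, y̲)`
    rw [hU]
    intro y' hy
    obtain ⟨y, rfl⟩ : ∃ y : E4, y = y' := ⟨y', rfl⟩
    have hp : E4.ofTimeSpace 0 (E4.spatial y) ∈ range Minkowski.vacuumCauchyDevelopment.embed :=
      ⟨⟨E4.spatial y, trivial⟩, rfl⟩
    refine LorentzianMetric.causalFuture_mono (g := Minkowski.vacuumCauchyDevelopment.metric)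
      (singleton_subset_iff.2 hp) ?_
    change y ∈ (LorentzianMetric.causalFuture
      (LorentzianMetric.ofLE (n' := (∞ : ℕ∞ω)) Minkowski.metric le_top)
      (TimeOrientation.ofLE (n' := (∞ : ℕ∞ω)) Minkowski.timeOrientation le_top)
      {E4.ofTimeSpace 0 (E4.spatial y)} : Set E4)
    rw [Minkowski.causalFuture_singleton]
    simp only [Set.mem_setOf_eq, E4.spatial_ofTimeSpace, sub_self, norm_zero, E4.ofTimeSpace_apply_zero,
      sub_zero]
    exact hy.le
  · -- (E4) `dΨ(∂₀) = ∂₀` is future timelike for `(η, ∂ₜ)`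
    intro x _
    rw [happ x]
    refine ⟨?_, ⟨?_, ?_⟩, ?_⟩
    · change Minkowski.bilin (E4.basisVector 0) (E4.basisVector 0) < 0
      rw [Minkowski.bilin_basisVector_zero]; norm_num
    · change Minkowski.bilin (E4.basisVector 0) (E4.basisVector 0) ≤ 0
      rw [Minkowski.bilin_basisVector_zero]; norm_num
    · change (E4.basisVector 0 : E4) ≠ 0
      intro h
      have := congrArg (fun v : E4 ↦ v 0) h
      simp [E4.basisVector] at this
    · change Minkowski.bilin (E4.basisVector 0) (E4.basisVector 0) < 0
      rw [Minkowski.bilin_basisVector_zero]; norm_num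
  · -- (E5) the deviation vanishes identically
    have hdev : Minkowski.vacuumCauchyDevelopment.toSpacetime.deviationExtend Minkowski.background Ψ = 0 := by
      funext y
      have h := Minkowski.vacuumCauchyDevelopment.toSpacetime.deviationExtend_coe Minkowski.background Ψ
        ⟨y, trivial⟩
      rw [show (y : E4) = ((⟨y, trivial⟩ : Minkowski.background.domain) : E4) from rfl, h]
      ext v w
      rw [Spacetime.deviation_apply, happ, happ]
      change Minkowski.bilin v w - Minkowski.bilin v w = (0 : E4 →L[ℝ] E4 →L[ℝ] ℝ) v w
      rw [sub_self]
      rfl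
    have hzero : ∀ τ, Minkowski.vacuumCauchyDevelopment.toSpacetime.deviationCk Minkowski.background Ψ 2 τ
        = 0 := fun τ ↦ by
      unfold Spacetime.deviationCk
      rw [hdev]
      exact supCkENorm_zero _ _
    simp only [hzero]
    exact tendsto_const_nhds
  · -- (E6) every event `q` lies in `I⁻({x⁰ > 0})`: vertical timelike segment to `(max q⁰ 0 + 1, q̲)`
    rw [hU]
    intro q' _
    -- read the event as a point of `E4` (the carrier is `E4` by `rfl`)
    obtain ⟨q, rfl⟩ : ∃ q : E4, q = q' := ⟨q', rfl⟩
    set x : E4 := q + (max (q 0) 0 + 1 - q 0) • (E4.basisVector 0 : E4) with hx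
    have hx0 : x 0 = max (q 0) 0 + 1 := by
      simp [hx, E4.basisVector]
    have hxU : x ∈ {y : E4 | 0 < y 0} := by
      show 0 < x 0
      rw [hx0]
      exact lt_of_le_of_lt (le_max_right _ _) (lt_add_one _)
    have hsp : E4.spatial x = E4.spatial q := by
      rw [hx, map_add, map_smul]
      have : E4.spatial (E4.basisVector 0 : E4) = 0 := by
        ext i
        simp [E4.basisVector, Fin.succ_ne_zero]
      rw [this, smul_zero, add_zero]
    have hqt : q 0 < x 0 := by
      rw [hx0]
      exact lt_of_le_of_lt (le_max_left _ _) (lt_add_one _)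
    have hI : x ∈ (Minkowski.vacuumCauchyDevelopment.metric.chronologicalFuture
        Minkowski.vacuumCauchyDevelopment.timeOrientation {q} : Set E4) :=
      Minkowski.mem_chronologicalFuture_of_spatial_eq hsp hqt
    have hq : q ∈ (Minkowski.vacuumCauchyDevelopment.metric.chronologicalPast
        Minkowski.vacuumCauchyDevelopment.timeOrientation {x} : Set E4) :=
      LorentzianMetric.mem_chronologicalPast_of_mem_chronologicalFuture
        (g := Minkowski.vacuumCauchyDevelopment.metric) hI
    exact LorentzianMetric.chronologicalFuture_mono (g := Minkowski.vacuumCauchyDevelopment.metric)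
      (singleton_subset_iff.2 hxU) hq

/-- **Minkowski space settles honestly (`N = 0`, re-typed Statement T2)**: the Minkowski development of the
trivial datum satisfies the conclusion of the crux `DrainImpliesDisperse` verbatim — some `O` (namely
`exteriorOf 𝒟 {x⁰ > 0} = J⁺({x⁰ = 0})`) carries an `N = 0` final-state decomposition `d` in `C²` with
`O = exteriorOf 𝒟 d.charted`, `RaysStayInClosure 𝒟 O`, `HasExhaustiveCharts d`, `IsFutureOriented d`. From
`minkowski_horizonlessRadiativeEnd` by the landed reduction `settles_of_horizonlessRadiativeEnd`.
Christodoulou–Klainerman 1993, Thm. 1.0.2 (Minkowski space is its own final state). -/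
theorem minkowski_settlesT2 :
    ∃ (O : Set Minkowski.vacuumCauchyDevelopment.carrier)
      (d : FinalStateDecomposition Minkowski.vacuumCauchyDevelopment.toSpacetime O 2),
      d.N = 0 ∧ O = exteriorOf Minkowski.vacuumCauchyDevelopment.toCauchyDevelopment d.charted ∧
        RaysStayInClosure Minkowski.vacuumCauchyDevelopment.toCauchyDevelopment O ∧
        HasExhaustiveCharts d ∧ IsFutureOriented d := by
  obtain ⟨τ₀, Ψ, h1, h2, h3, h4, h5, h6, h7⟩ := minkowski_horizonlessRadiativeEnd
  exact settles_of_horizonlessRadiativeEnd _ _ Minkowski.vacuumCauchyDevelopment.toCauchyDevelopment τ₀ Ψ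
    h1 h2 h3 h4 h5 h6 h7

end Summit.FinalStateConjecture.FinalStateConjecture.Theorems.DrainImpliesDisperse

end
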